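import Summits.QuantumAdvantage.QuantumAdvantage.Theorems.MobiusLadderLiouvilleOrthogonalTC0FewMajSens3
import Summits.QuantumAdvantage.QuantumAdvantage.Theorems.MobiusLadderLiouvilleOrthogonalTC0FewLtfAC0
import HarnessLib

/-!
# Crux `MobiusLadder.LiouvilleOrthogonalTC0` (stmt-QuantumAdvantage-1393): the few-majority rung — `λ` is
orthogonal to every polynomial-size `AC⁰` circuit augmented with `O(log n)` majority gates at the bottom

Line `Sketch`, skeleton v7 (lead `prover-line-stmt-QuantumAdvantage-1393-c4-0`). The parameter analysis
on top of the accounting file `…FewMajSens3.lean` (`FewMaj3.tailWeight_fewMaj_le`: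
`W^{≥m}[sgn ∘ C] ≤ 3(k + 2^kΦ(d,s)/√m)/√m` for a `tcBasis` circuit with `k` majority gates of fan-in `≥ 3`, all at the
bottom, `Φ(d,s) = A^{d+2}B^{d+2}(logM 2s)^d/log 2`): at the spectral level `m = ⌊n^{1/R}⌋₊ + 1`
(`R = ⌈3/c⌉₊`, `c` = Bourgain's exponent, `δ = 1/(2R)`), with `k ≤ δ log n` (so `2^k ≤ n^δ`),
`s = max(2, p(n)) ≤ n^{deg p+2}` (so `logM(2s) ≤ 5(deg p + 2) log n`, `ACForm.logM_two_mul_le`) and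
`(log n)^d ≤ (2(d+1)/δ)^d n^{δ/2}` (`Real.log_natCast_le_rpow_div`; parameter lemmas `FewMaj3.eventually_logM_le`,
`FewMaj3.log_pow_le` of `…FewLtfAC0.lean`, the gate-free form of this rung), the tail is
`≤ (6 + 3 A^{d+2}B^{d+2}(5(deg p+2))^d(2(d+1)/δ)^d/log 2) · n^{-δ/2} → 0`, and the single-level
spectral criterion `liouville_orthogonal_of_tailWeight_level` (Bourgain + Green §2) applies.

* `liouville_orthogonal_fewMaj` — there is `c₀ > 0` such that for all `d`, `p`, `ε > 0`, eventually in
  `n`, every circuit over `tcBasis` of `acDepth ≤ d`, `size ≤ p(n)`, whose majority gates of fan-in `≥ 3`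
  sit at `acWeight`-depth `≤ 1` and are at most `c₀ log n` in number has `|Σ_{N<2ⁿ} λ(N) sgn C(bits N)| ≤ ε 2ⁿ` (registered stub
  `stub_fewMaj`). Green's `AC⁰` theorem is the case of no majority gate.
-/

set_option linter.dupNamespace false -- D-0017: single-problem summit ⇒ `QuantumAdvantage.QuantumAdvantage` by design

noncomputable section

namespace Summit.QuantumAdvantage.QuantumAdvantage.Theorems.LiouvilleOrthogonalTC0

open Filter Finset Topology
open Literature.Computability.Complexity
open Literature.Computability.Complexity.GateList
open Literature.Computability.Complexity.LowDegree (tailWeight)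
open Literature.Probability.RandomGraphs.LowDegree (sgn)
open Literature.NumberTheory.Sieve

/-! ### The rung -/


open FewMaj3 in
/-- **The few-majority rung: `λ` is orthogonal to every polynomial-size constant-depth circuit over
`tcBasis` with at most `c₀ log n` majority gates of fan-in `≥ 3`, all at the bottom** (unconditional;
`MAJ₀ = ∧₀`, `MAJ₁ = ∧₁`, `MAJ₂ = ∨₂` are `AC⁰` gates and unconstrained). There is `c₀ > 0`
(depending only on the exponent of Bourgain's Möbius–Walsh bound) such that for every depth `d`, size
polynomial `p` and `ε > 0`, eventually in `n`: every circuit `C` over `tcBasis` on the `n` binary digits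
with `acDepth ≤ d`, `size ≤ p(n)`, every majority gate of fan-in `≥ 3` at `acWeight`-depth `≤ 1`, and at
most `c₀ log n` of them has `|Σ_{N<2ⁿ} λ(N) sgn C(bits N)| ≤ ε 2ⁿ`. -/
theorem liouville_orthogonal_fewMaj : ∃ c₀ : ℝ, 0 < c₀ ∧ ∀ (d : ℕ) (p : Polynomial ℕ) (ε : ℝ), 0 < ε →
    ∀ᶠ n : ℕ in atTop, ∀ C : Circuit (Fin n), C.IsOver tcBasis → C.acDepth ≤ d → C.size ≤ p.eval n →
      (∀ (j : ℕ) (hj : j < C.gates.length), (∃ k, 3 ≤ k ∧ (C.gates[j]).fn = GateFn.maj k) →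
        (GateList.wdepths acWeight C.gates).getD j 0 ≤ 1) →
      (((Finset.univ.filter fun j : Fin C.gates.length =>
          3 ≤ (C.gates[j]).arity ∧ (C.gates[j]).fn = GateFn.maj (C.gates[j]).arity).card : ℝ) ≤ c₀ * Real.log n) →
        |∑ N ∈ Finset.range (2 ^ n), ((ArithmeticFunction.liouville N : ℤ) : ℝ) *
            sgn (C.eval (fun i : Fin n => Nat.testBit N i))| ≤ ε * (2 : ℝ) ^ n := by
  obtain ⟨c, hc, hB⟩ := bourgain_liouville_walsh_holds
  set R : ℕ := ⌈(3 : ℝ) / c⌉₊ with hRdef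
  have hR1 : 1 ≤ R := by
    have : (0 : ℝ) < 3 / c := by positivity
    exact Nat.one_le_iff_ne_zero.mpr (Nat.pos_iff_ne_zero.mp (Nat.ceil_pos.mpr this))
  have hRc : 3 ≤ (R : ℝ) * c := by
    have h1 : (3 : ℝ) / c ≤ R := Nat.le_ceil _
    have := mul_le_mul_of_nonneg_right h1 hc.le
    rwa [div_mul_cancel₀ _ hc.ne'] at this
  have hRpos : (0 : ℝ) < R := by exact_mod_cast (show 0 < R by omega)
  set δ : ℝ := 1 / (2 * R) with hδdef
  have hδ : 0 < δ := by positivity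
  have hδ1 : δ ≤ 1 := by
    rw [hδdef, div_le_one (by positivity)]
    have : (1 : ℝ) ≤ R := by exact_mod_cast hR1
    linarith
  have h2δ : 2 * δ = 1 / R := by rw [hδdef]; field_simp
  refine ⟨δ, hδ, fun d p ε hε => ?_⟩
  have hε3 : 0 < (ε / 3) ^ 2 := by positivity
  -- the constants of the majorant `(6 + 3 A^{d+2}B^{d+2} (5(deg+2))^d (2(d+1)/δ)^d / log 2) · n^{-δ/2}`
  set D : ℝ := 5 * ((p.natDegree : ℝ) + 2) with hDdef
  set KK : ℝ := (ACForm.cA : ℝ) ^ (d + 2) * (ACForm.cB : ℝ) ^ (d + 2) * D ^ d / Real.log 2 with hKKdef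
  have hl2 : 0 < Real.log 2 := Real.log_pos (by norm_num)
  have hKK0 : 0 ≤ KK := by rw [hKKdef, hDdef]; positivity
  set M : ℝ := 6 + 3 * KK * (2 * ((d : ℝ) + 1) / δ) ^ d with hMdef
  have hdec : Tendsto (fun n : ℕ => M * (n : ℝ) ^ (-(δ / 2))) atTop (𝓝 0) := by
    have h1 : Tendsto (fun n : ℕ => (n : ℝ) ^ (-(δ / 2))) atTop (𝓝 0) :=
      (tendsto_rpow_neg_atTop (by positivity)).comp tendsto_natCast_atTop_atTop
    simpa using h1.const_mul M
  have hlev9 : ∀ᶠ n : ℕ in atTop, 9 ≤ ⌊((n : ℝ)) ^ ((1 : ℝ) / R)⌋₊ :=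
    (LtfCore.tendsto_floor_rpow hR1).eventually (eventually_ge_atTop 9)
  filter_upwards [liouville_orthogonal_of_tailWeight_level hc hB hR1 hRc ε hε,
    hdec.eventually_le_const hε3, hlev9, eventually_ge_atTop 2, eventually_logM_le p d]
    with n hn hsmall h9 hn2 hlogM C hCB hd hs hMd hcount
  refine hn (fun y => C.eval y) ?_
  set kk : ℕ := ⌊((n : ℝ)) ^ ((1 : ℝ) / R)⌋₊ with hkkdef
  set s : ℕ := max 2 (p.eval n) with hsdef
  have hs1 : 1 ≤ s := le_trans (by norm_num) (le_max_left _ _)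
  have hCs : C.size ≤ s := hs.trans (le_max_right _ _)
  have htail := tailWeight_fewMaj_le (m := kk + 1) (by omega) C hCB hd hCs hs1 hMd
  refine htail.trans (le_trans ?_ hsmall)
  -- abbreviations
  set k : ℕ := (Finset.univ.filter fun j : Fin C.gates.length =>
    3 ≤ (C.gates[j]).arity ∧ (C.gates[j]).fn = GateFn.maj (C.gates[j]).arity).card with hkdef
  set Φ : ℝ := (ACForm.cA : ℝ) ^ (d + 2) * (ACForm.cB : ℝ) ^ (d + 2) *
    (ACForm.logM (2 * s) : ℝ) ^ d / Real.log 2 with hΦdef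
  have hΦ0 : 0 ≤ Φ := by rw [hΦdef]; positivity
  have hnpos : (0 : ℝ) < n := by exact_mod_cast (show 0 < n by omega)
  have hn1 : (1 : ℝ) ≤ n := by exact_mod_cast (show 1 ≤ n by omega)
  have hlogn : 0 ≤ Real.log n := Real.log_nonneg hn1
  -- the level: `n^δ ≤ √(kk+1)`, `n^{2δ} ≤ kk + 1`
  have hlev : (n : ℝ) ^ (2 * δ) < (kk : ℝ) + 1 := by rw [h2δ]; exact Nat.lt_floor_add_one _
  have hsq : (n : ℝ) ^ δ ≤ Real.sqrt ((((kk + 1 : ℕ) : ℝ))) := by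
    have h1 : Real.sqrt ((n : ℝ) ^ (2 * δ)) ≤ Real.sqrt ((kk : ℝ) + 1) := Real.sqrt_le_sqrt hlev.le
    have h2 : Real.sqrt ((n : ℝ) ^ (2 * δ)) = (n : ℝ) ^ δ := by
      rw [Real.sqrt_eq_rpow, ← Real.rpow_mul hnpos.le]; congr 1; ring
    rw [h2] at h1; push_cast; exact h1
  have hm : (n : ℝ) ^ (2 * δ) ≤ ((((kk + 1 : ℕ) : ℝ))) := by push_cast; exact hlev.le
  have hnδ : (0 : ℝ) < (n : ℝ) ^ δ := Real.rpow_pos_of_pos hnpos _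
  have hn2δ : (0 : ℝ) < (n : ℝ) ^ (2 * δ) := Real.rpow_pos_of_pos hnpos _
  have hs0 : (0 : ℝ) < Real.sqrt ((((kk + 1 : ℕ) : ℝ))) := lt_of_lt_of_le hnδ hsq
  have hm0 : (0 : ℝ) < ((((kk + 1 : ℕ) : ℝ))) := lt_of_lt_of_le hn2δ hm
  -- `2^k ≤ n^δ` from `k ≤ δ log n`
  have h2k : (2 : ℝ) ^ k ≤ (n : ℝ) ^ δ := by
    have hk : (k : ℝ) ≤ δ * Real.log n := hcount
    have hlog2 : Real.log 2 ≤ 1 := by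
      have := Real.log_two_lt_d9; linarith
    calc (2 : ℝ) ^ k = Real.exp (k * Real.log 2) := by
          rw [← Real.rpow_natCast, Real.rpow_def_of_pos (by norm_num)]; ring_nf
      _ ≤ Real.exp (δ * Real.log n) := by
          refine Real.exp_le_exp.2 ?_
          calc (k : ℝ) * Real.log 2 ≤ k * 1 := mul_le_mul_of_nonneg_left hlog2 (Nat.cast_nonneg k)
            _ = k := mul_one _
            _ ≤ δ * Real.log n := hk
      _ = (n : ℝ) ^ δ := by rw [Real.rpow_def_of_pos hnpos]; ring_nf
  -- `Φ ≤ KK (log n)^d ≤ KK (2(d+1)/δ)^d n^{δ/2}`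
  have hΦle : Φ ≤ KK * (2 * ((d : ℝ) + 1) / δ) ^ d * (n : ℝ) ^ (δ / 2) := by
    have h1 : ((ACForm.logM (2 * s) : ℝ)) ^ d ≤ (D * Real.log n) ^ d := by
      rw [hDdef, hsdef]; exact hlogM
    have h2 : (D * Real.log n) ^ d = D ^ d * Real.log n ^ d := mul_pow _ _ _
    have h3 := log_pow_le hδ d (show 1 ≤ n by omega)
    have hD0 : 0 ≤ D := by rw [hDdef]; positivity
    calc Φ = (ACForm.cA : ℝ) ^ (d + 2) * (ACForm.cB : ℝ) ^ (d + 2) / Real.log 2 *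
          ((ACForm.logM (2 * s) : ℝ)) ^ d := by rw [hΦdef]; ring
      _ ≤ (ACForm.cA : ℝ) ^ (d + 2) * (ACForm.cB : ℝ) ^ (d + 2) / Real.log 2 *
          (D ^ d * ((2 * ((d : ℝ) + 1) / δ) ^ d * (n : ℝ) ^ (δ / 2))) := by
          refine mul_le_mul_of_nonneg_left ?_ (by positivity)
          calc ((ACForm.logM (2 * s) : ℝ)) ^ d ≤ (D * Real.log n) ^ d := h1
            _ = D ^ d * Real.log n ^ d := h2
            _ ≤ D ^ d * ((2 * ((d : ℝ) + 1) / δ) ^ d * (n : ℝ) ^ (δ / 2)) :=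
                mul_le_mul_of_nonneg_left h3 (by positivity)
      _ = KK * (2 * ((d : ℝ) + 1) / δ) ^ d * (n : ℝ) ^ (δ / 2) := by rw [hKKdef]; ring
  -- `log n ≤ (2/δ) n^{δ/2}` (the case `d = 1` of `log_pow_le`, spelled out)
  have hlogle : Real.log n ≤ (2 / δ) * (n : ℝ) ^ (δ / 2) := by
    have h := Real.log_natCast_le_rpow_div n (show 0 < δ / 2 by positivity)
    calc Real.log n ≤ (n : ℝ) ^ (δ / 2) / (δ / 2) := h
      _ = (2 / δ) * (n : ℝ) ^ (δ / 2) := by field_simp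
  -- assemble: `3(k + 2^kΦ/√m)/√m ≤ 3k/n^δ + 3·2^kΦ/n^{2δ} ≤ (6 + 3KK(…)^d) n^{-δ/2}`
  have hk0 : (0 : ℝ) ≤ k := Nat.cast_nonneg k
  have e1 : (n : ℝ) ^ (δ / 2) / (n : ℝ) ^ δ = (n : ℝ) ^ (-(δ / 2)) := by
    rw [← Real.rpow_sub hnpos]; congr 1; ring
  have e2 : (n : ℝ) ^ δ * (n : ℝ) ^ (δ / 2) / (n : ℝ) ^ (2 * δ) = (n : ℝ) ^ (-(δ / 2)) := by
    rw [← Real.rpow_add hnpos, ← Real.rpow_sub hnpos]; congr 1; ring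
  calc 3 * ((k : ℝ) + 2 ^ k * Φ / Real.sqrt ((((kk + 1 : ℕ) : ℝ)))) / Real.sqrt ((((kk + 1 : ℕ) : ℝ)))
      = 3 * (k : ℝ) / Real.sqrt ((((kk + 1 : ℕ) : ℝ))) +
          3 * (2 ^ k * Φ) / (Real.sqrt ((((kk + 1 : ℕ) : ℝ))) * Real.sqrt ((((kk + 1 : ℕ) : ℝ)))) := by
        field_simp
    _ = 3 * (k : ℝ) / Real.sqrt ((((kk + 1 : ℕ) : ℝ))) + 3 * (2 ^ k * Φ) / ((((kk + 1 : ℕ) : ℝ))) := by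
        rw [Real.mul_self_sqrt hm0.le]
    _ ≤ 3 * (k : ℝ) / (n : ℝ) ^ δ + 3 * (2 ^ k * Φ) / (n : ℝ) ^ (2 * δ) := by
        gcongr
    _ ≤ 3 * (δ * Real.log n) / (n : ℝ) ^ δ + 3 * ((n : ℝ) ^ δ * (KK * (2 * ((d : ℝ) + 1) / δ) ^ d *
          (n : ℝ) ^ (δ / 2))) / (n : ℝ) ^ (2 * δ) := by
        gcongr
    _ ≤ 3 * (δ * ((2 / δ) * (n : ℝ) ^ (δ / 2))) / (n : ℝ) ^ δ + 3 * ((n : ℝ) ^ δ * (KK * (2 * ((d : ℝ) + 1) / δ) ^ d *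
          (n : ℝ) ^ (δ / 2))) / (n : ℝ) ^ (2 * δ) := by
        gcongr
    _ = 6 * ((n : ℝ) ^ (δ / 2) / (n : ℝ) ^ δ) +
          3 * KK * (2 * ((d : ℝ) + 1) / δ) ^ d * ((n : ℝ) ^ δ * (n : ℝ) ^ (δ / 2) / (n : ℝ) ^ (2 * δ)) := by
        field_simp
        ring
    _ = M * (n : ℝ) ^ (-(δ / 2)) := by rw [e1, e2, hMdef]; ring

/-- **Registered stub `stub_fewMaj`** (line `Sketch`, skeleton v7, lead c4): verbatim
`liouville_orthogonal_fewMaj`. -/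
theorem stub_fewMaj : ∃ c₀ : ℝ, 0 < c₀ ∧ ∀ (d : ℕ) (p : Polynomial ℕ) (ε : ℝ), 0 < ε → ∀ᶠ n : ℕ in atTop, ∀ C : Circuit (Fin n), C.IsOver tcBasis → C.acDepth ≤ d → C.size ≤ p.eval n → (∀ (j : ℕ) (hj : j < C.gates.length), (∃ k, 3 ≤ k ∧ (C.gates[j]).fn = GateFn.maj k) → (GateList.wdepths acWeight C.gates).getD j 0 ≤ 1) → (((Finset.univ.filter fun j : Fin C.gates.length => 3 ≤ (C.gates[j]).arity ∧ (C.gates[j]).fn = GateFn.maj (C.gates[j]).arity).card : ℝ) ≤ c₀ * Real.log n) → |∑ N ∈ Finset.range (2 ^ n), ((ArithmeticFunction.liouville N : ℤ) : ℝ) * sgn (C.eval (fun i : Fin n => Nat.testBit N i))| ≤ ε * (2 : ℝ) ^ n :=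
  liouville_orthogonal_fewMaj

end Summit.QuantumAdvantage.QuantumAdvantage.Theorems.LiouvilleOrthogonalTC0

end
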